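import Literature.Algebra.Module.DVRModuleType
import HarnessLib

/-!
# Torsion modules over a discrete valuation ring whose intermediate elementary divisors pair up:
# `N ≅ (R/ϖᵏ)^ε ⊕ M ⊕ M` from even socle layers — the ALGEBRAIC half of Howard 2004, Thm. 1.4.2

Topic `Algebra/Module`; namespace `Literature.Algebra.Module`. THEOREMS ONLY: no definition, no named
fact, no instance, no sorry (net debt 0). Companion file: `PairedTorsionModulesAlternating.lean` (how an
alternating pairing produces the even layers, and the parity `ε ≡ dim N[ϖ] (mod 2)` of Prop. 1.5.5).
Parents used by name: `DVRModuleType.lean` (`exists_linearEquiv_pi_quotient_uniformizer_pow_of_isTorsion`: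
`N ≅ Π R/(ϖ^{aᵢ})`), `PIDInvariantFactors.lean` (the residue-dimension counts `finrank_torsionBy_*`),
`PIDModuleCancellation.lean` (`nonempty_pi_quotient_linearEquiv_of_associated`: reindexing products of
cyclic modules).

## Source, verbatim

B. Howard, *The Heegner point Kolyvagin system*, Compositio Math. 140 (2004) 1439–1472, §1.4
(= arXiv:1202.6340 §2.4, held text `paper:arxiv-1202.6340` p0008 L100–L139). `R` is a principal
Artinian local ring of length `k` with maximal ideal `𝔪 = (π)`, `𝓗 = H¹_𝓕(K, T)` a finitely generated
`R`-module:

> **Theorem 1.4.2.** There is an `R`-module `M` and an integer `ε` such that `H¹_𝓕(K,T) ≅ R^ε ⊕ M ⊕ M`.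
> By the structure theorem for finitely-generated modules over `R`, we may assume `ε ∈ {0,1}`.
> *Proof.* Abbreviate `𝓗 = H¹_𝓕(K,T)`, and for `1 ≤ s < k` define `V_s = 𝓗[𝔪ˢ]/𝔪𝓗[𝔪^{s+1}]` … We claim
> that for `0 ≤ s < k`, the `R/𝔪`-vector space `V_s` [sc. `V_s/V_{s-1}`] is even dimensional. The claim
> then follows easily from this and the structure theorem for finitely-generated `R`-modules. There is
> an exact sequence `0 → V_{s-1} → V_s → W_s` … We define a pairing `⟨ , ⟩ : V_s × V_s → R[𝔪]` by
> `⟨a, b⟩ = (a, π^{s-1}b)_{s,1}`. The kernel on the right is `V_{s-1}`. If we can show that this pairing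
> is alternating, then `V_s/V_{s-1}` is even dimensional for every `1 ≤ s < k`, and the claim follows.

This file proves the two algebraic sentences ("The claim then follows easily …", "we may assume
`ε ∈ {0,1}`") over a discrete valuation ring `R` with uniformiser `ϖ` for a finitely generated module `N`
killed by `ϖᵏ` (equivalently, a finitely generated module over the principal Artinian ring `R/ϖᵏ`). The
Galois-cohomological input — Prop. 1.4.1 (Flach's generalized Cassels–Tate pairing `( , )_{s,t}` and its
kernels), the identifications of Lemma 1.3.3 and the alternation computation p0008 L140–p0009 L55 — is
NOT formalised here; the companion file states the exact shape in which it enters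
(`even_length_torsionLayer_of_isAlt`).

## What is proved (theorems only)

* §1 (any commutative ring) `nonempty_torsionLayer_linearEquiv`: Howard's layer
  `V_s/V_{s-1} = N[ϖˢ]/(N[ϖ^{s-1}] + ϖ·N[ϖ^{s+1}])` is, via `x ↦ ϖ^{s-1}x`, the socle layer
  `(N[ϖ] ∩ ϖ^{s-1}N)/(N[ϖ] ∩ ϖˢN)`; `length_torsionLayer_add_length`.
* §2 (DVR) `length_torsionLayer_eq_card_of_linearEquiv`: **for `N ≅ Π_i R/(ϖ^{aᵢ})` the layer `s` has
  length `#{i : aᵢ = s}`** — the multiplicity of the elementary divisor `ϖˢ` (Macdonald's conjugate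
  partition count `finrank_torsionBy_smul_top_eq_card_of_linearEquiv`: `dim (ϖʲN)[ϖ] = #{i : j < aᵢ}`).
* §3 (any domain) `exists_linearEquiv_pi_prod_pi_prod_self_of_even_card_fiber`: if every exponent `< k`
  occurs an even number of times then `N ≅ (R/ϖᵏ)ᵈ × (M × M)`, `M = Π R/(ϖ^{b_x})`, `b_x < k`;
  `exists_linearEquiv_pi_prod_pi_prod_self_fold`: `(R/ϖᵏ)ᵈ × (M × M) ≅ (R/ϖᵏ)^{d mod 2} × (M' × M')`.
* §4 (DVR) **`exists_linearEquiv_pi_prod_pi_prod_self_of_even_length_torsionLayer`** — THM. 1.4.2,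
  ALGEBRAIC HALF: `N` finitely generated, `ϖᵏN = 0`, every layer `1 ≤ s < k` of even length ⟹
  `N ≃ₗ[R] (Fin ε → R/(ϖᵏ)) × ((Π_j R/(ϖ^{n_j})) × (Π_j R/(ϖ^{n_j})))` with `ε ≤ 1`, `1 ≤ n_j ≤ k`.

Everything is elementary module theory over a DVR; nothing here concerns Selmer groups, and Howard's
Theorem 1.4.2 itself (which needs the pairing) is NOT claimed.

## References

* [Howard2004HeegnerKolyvagin] B. Howard, *The Heegner point Kolyvagin system*, Compositio Math. 140
  (2004), no. 6, 1439–1472, Thm. 1.4.2 and its proof (arXiv:1202.6340 Thm. 2.4.2, p. 8).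
* [Macdonald1995] I. G. Macdonald, *Symmetric Functions and Hall Polynomials*, 2nd ed. (1995), Ch. II §1
  (1.4) (the type of a finite `𝔬`-module and its conjugate partition).
-/

open Module Submodule
open scoped Pointwise

namespace Literature.Algebra.Module

/-! ### §1 Howard's layer `V_s/V_{s-1} = N[ϖˢ]/(N[ϖ^{s-1}] + ϖN[ϖ^{s+1}])` is `(N[ϖ] ∩ ϖ^{s-1}N)/(N[ϖ] ∩ ϖˢN)` -/

section Layer

variable {R : Type*} [CommRing R] {N : Type*} [AddCommGroup N] [Module R N] (ϖ : R) (t : ℕ)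

/-- `ϖ^{t+1}N ⊆ ϖᵗN`. [folklore] -/
private theorem pow_succ_smul_top_le_pow_smul_top :
    ϖ ^ (t + 1) • (⊤ : Submodule R N) ≤ ϖ ^ t • (⊤ : Submodule R N) := by
  intro x hx
  obtain ⟨y, -, rfl⟩ := (mem_smul_pointwise_iff_exists _ _ _).1 hx
  exact (mem_smul_pointwise_iff_exists _ _ _).2 ⟨ϖ • y, mem_top, by rw [← mul_smul, ← pow_succ]⟩

/-- **Howard's layer is a layer of the socle filtration.** Multiplication by `ϖᵗ` induces an
`R`-linear isomorphism `N[ϖ^{t+1}]/(N[ϖᵗ] + ϖ·N[ϖ^{t+2}]) ≅ (N[ϖ] ∩ ϖᵗN)/(N[ϖ] ∩ ϖ^{t+1}N)`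
(Howard's `V_s/V_{s-1}` for `s = t + 1`, where `V_s = 𝓗[𝔪ˢ]/𝔪𝓗[𝔪^{s+1}]`): `x ↦ ϖᵗx` maps
`N[ϖ^{t+1}]` onto `N[ϖ] ∩ ϖᵗN`, and `ϖᵗx ∈ ϖ^{t+1}N` iff `x ∈ N[ϖᵗ] + ϖ·N[ϖ^{t+2}]`.
[cite: Howard2004HeegnerKolyvagin, Thm. 1.4.2 (proof) = arXiv:1202.6340 Thm. 2.4.2, p0008 L104–L139] -/
theorem nonempty_torsionLayer_linearEquiv :
    Nonempty ((↥(torsionBy R N (ϖ ^ (t + 1))) ⧸ comap (torsionBy R N (ϖ ^ (t + 1))).subtype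
        (torsionBy R N (ϖ ^ t) ⊔ ϖ • torsionBy R N (ϖ ^ (t + 2)))) ≃ₗ[R]
      (↥(torsionBy R N ϖ ⊓ ϖ ^ t • (⊤ : Submodule R N)) ⧸
        comap (torsionBy R N ϖ ⊓ ϖ ^ t • (⊤ : Submodule R N)).subtype
          (torsionBy R N ϖ ⊓ ϖ ^ (t + 1) • (⊤ : Submodule R N)))) := by
  set X := torsionBy R N (ϖ ^ (t + 1)) with hX
  set A₀ := torsionBy R N ϖ ⊓ ϖ ^ t • (⊤ : Submodule R N) with hA₀
  set A₁ := torsionBy R N ϖ ⊓ ϖ ^ (t + 1) • (⊤ : Submodule R N) with hA₁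
  have hψmem : ∀ x : X, ϖ ^ t • (x : N) ∈ A₀ := fun x ↦ by
    refine mem_inf.2 ⟨?_, smul_mem_pointwise_smul _ _ _ mem_top⟩
    rw [mem_torsionBy_iff, ← mul_smul, ← pow_succ']
    exact (mem_torsionBy_iff _ _).1 x.2
  let ψ : X →ₗ[R] A₀ :=
    { toFun := fun x ↦ ⟨ϖ ^ t • (x : N), hψmem x⟩
      map_add' := fun x y ↦ Subtype.ext (by simp only [coe_add, smul_add, AddMemClass.mk_add_mk])
      map_smul' := fun c x ↦ Subtype.ext (by
        simp only [SetLike.val_smul, RingHom.id_apply, SetLike.mk_smul_mk]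
        exact smul_comm _ _ _) }
  have hψapply : ∀ x : X, ((ψ x : A₀) : N) = ϖ ^ t • (x : N) := fun x ↦ rfl
  have hψsurj : Function.Surjective ψ := by
    rintro ⟨y, hy⟩
    obtain ⟨hy₁, hy₂⟩ := mem_inf.1 hy
    obtain ⟨z, -, rfl⟩ := (mem_smul_pointwise_iff_exists _ _ _).1 hy₂
    refine ⟨⟨z, ?_⟩, rfl⟩
    rw [mem_torsionBy_iff, pow_succ', mul_smul]
    exact (mem_torsionBy_iff _ _).1 hy₁
  let A₁' : Submodule R A₀ := comap A₀.subtype A₁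
  have hker : comap ψ A₁' =
      comap X.subtype (torsionBy R N (ϖ ^ t) ⊔ ϖ • torsionBy R N (ϖ ^ (t + 2))) := by
    ext x
    simp only [mem_comap, Submodule.subtype_apply, hψapply, A₁']
    constructor
    · rintro ⟨-, hx⟩
      obtain ⟨w, -, hw⟩ := (mem_smul_pointwise_iff_exists _ _ _).1 hx
      rw [mem_sup]
      refine ⟨(x : N) - ϖ • w, ?_, ϖ • w, smul_mem_pointwise_smul _ _ _ ?_, sub_add_cancel _ _⟩
      · rw [mem_torsionBy_iff, smul_sub, ← mul_smul, ← pow_succ, hw, sub_self]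
      · rw [mem_torsionBy_iff, pow_succ', mul_smul, hw, ← mul_smul, ← pow_succ']
        exact (mem_torsionBy_iff _ _).1 x.2
    · intro hx
      obtain ⟨y, hy, z, hz, hyz⟩ := mem_sup.1 hx
      obtain ⟨w, -, rfl⟩ := (mem_smul_pointwise_iff_exists _ _ _).1 hz
      refine ⟨(hψmem x).1, (mem_smul_pointwise_iff_exists _ _ _).2 ⟨w, mem_top, ?_⟩⟩
      rw [← hyz, smul_add, (mem_torsionBy_iff _ _).1 hy, zero_add, ← mul_smul, ← pow_succ]
  let g : X →ₗ[R] A₀ ⧸ A₁' := A₁'.mkQ ∘ₗ ψ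
  have hg : Function.Surjective g := (mkQ_surjective _).comp hψsurj
  have hkerg : LinearMap.ker g =
      comap X.subtype (torsionBy R N (ϖ ^ t) ⊔ ϖ • torsionBy R N (ϖ ^ (t + 2))) := by
    rw [LinearMap.ker_comp, ker_mkQ, hker]
  exact ⟨(quotEquivOfEq _ _ hkerg.symm).trans (g.quotKerEquivOfSurjective hg)⟩

/-- **Lengths along the socle filtration**: `ℓ(N[ϖ^{t+1}]/(N[ϖᵗ] + ϖN[ϖ^{t+2}])) + ℓ(N[ϖ] ∩ ϖ^{t+1}N)
= ℓ(N[ϖ] ∩ ϖᵗN)`. [cite: Howard2004HeegnerKolyvagin, Thm. 1.4.2 (proof) = arXiv:1202.6340 Thm. 2.4.2, p0008 L104–L115] -/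
theorem length_torsionLayer_add_length :
    Module.length R ((↥(torsionBy R N (ϖ ^ (t + 1))) ⧸ comap (torsionBy R N (ϖ ^ (t + 1))).subtype
        (torsionBy R N (ϖ ^ t) ⊔ ϖ • torsionBy R N (ϖ ^ (t + 2))))) +
      Module.length R ↥(torsionBy R N ϖ ⊓ ϖ ^ (t + 1) • (⊤ : Submodule R N)) =
    Module.length R ↥(torsionBy R N ϖ ⊓ ϖ ^ t • (⊤ : Submodule R N)) := by
  obtain ⟨e⟩ := nonempty_torsionLayer_linearEquiv (N := N) ϖ t
  have hle : torsionBy R N ϖ ⊓ ϖ ^ (t + 1) • (⊤ : Submodule R N) ≤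
      torsionBy R N ϖ ⊓ ϖ ^ t • (⊤ : Submodule R N) :=
    inf_le_inf_left _ (pow_succ_smul_top_le_pow_smul_top ϖ t)
  set A₁' : Submodule R ↥(torsionBy R N ϖ ⊓ ϖ ^ t • (⊤ : Submodule R N)) :=
    comap (torsionBy R N ϖ ⊓ ϖ ^ t • (⊤ : Submodule R N)).subtype
      (torsionBy R N ϖ ⊓ ϖ ^ (t + 1) • (⊤ : Submodule R N)) with hA₁'
  rw [e.length_eq, ← (comapSubtypeEquivOfLe hle).length_eq, add_comm]
  exact (Module.length_eq_add_of_exact A₁'.subtype A₁'.mkQ (injective_subtype _) (mkQ_surjective _)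
    (LinearMap.exact_subtype_mkQ A₁')).symm

/-- `N[ϖ] ∩ ϖʲN ≅ (ϖʲN)[ϖ]` (the same elements). [folklore] -/
private theorem nonempty_torsionBy_inf_smul_top_linearEquiv (j : ℕ) :
    Nonempty (↥(torsionBy R N ϖ ⊓ ϖ ^ j • (⊤ : Submodule R N)) ≃ₗ[R]
      ↥(torsionBy R ↥(ϖ ^ j • (⊤ : Submodule R N)) ϖ)) := by
  let f : ↥(torsionBy R N ϖ ⊓ ϖ ^ j • (⊤ : Submodule R N)) →ₗ[R]
      ↥(torsionBy R ↥(ϖ ^ j • (⊤ : Submodule R N)) ϖ) :=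
    { toFun := fun y ↦ ⟨⟨(y : N), y.2.2⟩, by
        rw [mem_torsionBy_iff]
        exact Subtype.ext ((mem_torsionBy_iff _ _).1 y.2.1)⟩
      map_add' := fun _ _ ↦ rfl
      map_smul' := fun _ _ ↦ rfl }
  refine ⟨LinearEquiv.ofBijective f ⟨fun x y hxy ↦ ?_, fun z ↦ ?_⟩⟩
  · exact Subtype.ext (congrArg
      (fun w : ↥(torsionBy R ↥(ϖ ^ j • (⊤ : Submodule R N)) ϖ) ↦
        ((w : ↥(ϖ ^ j • (⊤ : Submodule R N))) : N)) hxy)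
  · have hz := (mem_torsionBy_iff _ _).1 z.2
    refine ⟨⟨((z : ↥(ϖ ^ j • (⊤ : Submodule R N))) : N), mem_inf.2 ⟨?_, z.1.2⟩⟩, rfl⟩
    rw [mem_torsionBy_iff]
    exact congrArg (fun w : ↥(ϖ ^ j • (⊤ : Submodule R N)) ↦ (w : N)) hz

end Layer

/-! ### §2 Over a discrete valuation ring: the layer counts the cyclic summands of length exactly `s` -/

section DVR

variable {R : Type*} [CommRing R] [IsDomain R] [IsDiscreteValuationRing R] {ϖ : R}
variable {N : Type*} [AddCommGroup N] [Module R N]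

/-- `ℓ_R(N[ϖ] ∩ ϖʲN) = dim_{R/(ϖ)} (ϖʲN)[ϖ]` for a finitely generated `N`. [folklore] -/
private theorem length_torsionBy_inf_smul_top_eq_finrank (hϖ : Irreducible ϖ) [Module.Finite R N] (j : ℕ) :
    Module.length R ↥(torsionBy R N ϖ ⊓ ϖ ^ j • (⊤ : Submodule R N)) =
      Module.finrank (R ⧸ R ∙ ϖ) ↥(torsionBy R ↥(ϖ ^ j • (⊤ : Submodule R N)) ϖ) := by
  haveI : Ideal.IsMaximal (R ∙ ϖ) := PrincipalIdealRing.isMaximal_of_irreducible hϖ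
  letI : Field (R ⧸ R ∙ ϖ) := Ideal.Quotient.field (R ∙ ϖ)
  haveI : IsNoetherian R N := isNoetherian_of_isNoetherianRing_of_finite R N
  haveI : Module.Finite (R ⧸ R ∙ ϖ) ↥(torsionBy R ↥(ϖ ^ j • (⊤ : Submodule R N)) ϖ) :=
    finite_torsionBy ϖ
  obtain ⟨e⟩ := nonempty_torsionBy_inf_smul_top_linearEquiv (N := N) ϖ j
  rw [e.length_eq, Module.length_eq_of_surjective (S := R) (R := R ⧸ R ∙ ϖ)
    (M := ↥(torsionBy R ↥(ϖ ^ j • (⊤ : Submodule R N)) ϖ)) Ideal.Quotient.mk_surjective,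
    Module.length_eq_finrank]

/-- **The count `dim_{R/(ϖ)} (ϖʲN)[ϖ] = #{i : j < aᵢ}` for `N ≅ Π R/(ϖ^{aᵢ})`** (Macdonald's conjugate
partition, transported along the isomorphism). [cite: Macdonald1995, Ch. II §1 (1.4) (PDF p. 155)] -/
theorem finrank_torsionBy_smul_top_eq_card_of_linearEquiv (hϖ : Irreducible ϖ) {ι : Type*} [Fintype ι]
    {a : ι → ℕ} (e : N ≃ₗ[R] Π i, R ⧸ Ideal.span {ϖ ^ a i}) (j : ℕ) :
    Module.finrank (R ⧸ R ∙ ϖ) ↥(torsionBy R ↥(ϖ ^ j • (⊤ : Submodule R N)) ϖ) =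
      (Finset.univ.filter fun i ↦ j < a i).card := by
  classical
  have hp : Prime ϖ := hϖ.prime
  obtain ⟨e₁⟩ := nonempty_smul_top_linearEquiv_of_linearEquiv e (ϖ ^ j)
  obtain ⟨e₂⟩ := nonempty_smul_top_pi_linearEquiv (R := R) (N := fun i ↦ R ⧸ Ideal.span {ϖ ^ a i})
    (ϖ ^ j)
  rw [finrank_torsionBy_eq_of_linearEquiv (e₁.trans e₂) ϖ, finrank_torsionBy_pi hp, Finset.card_filter]
  refine Finset.sum_congr rfl fun i _ ↦ ?_
  rw [finrank_torsionBy_smul_top_quotient hp (pow_ne_zero _ hϖ.ne_zero) j]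
  exact if_congr ((pow_dvd_pow_iff hϖ.ne_zero hϖ.not_isUnit).trans Nat.succ_le_iff) rfl rfl

/-- **Howard's layer counts the summands of length exactly `s`: `ℓ_R(N[ϖˢ]/(N[ϖ^{s-1}] + ϖN[ϖ^{s+1}]))
= #{i : aᵢ = s}` for `N ≅ Π R/(ϖ^{aᵢ})`** (`s = t + 1 ≥ 1`) — "`V_s/V_{s-1}` is even dimensional …
the claim then follows easily from this and the structure theorem".
[cite: Howard2004HeegnerKolyvagin, Thm. 1.4.2 (proof) = arXiv:1202.6340 Thm. 2.4.2, p0008 L104–L115] -/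
theorem length_torsionLayer_eq_card_of_linearEquiv (hϖ : Irreducible ϖ) {ι : Type*} [Fintype ι]
    {a : ι → ℕ} (e : N ≃ₗ[R] Π i, R ⧸ Ideal.span {ϖ ^ a i}) (t : ℕ) :
    Module.length R ((↥(torsionBy R N (ϖ ^ (t + 1))) ⧸ comap (torsionBy R N (ϖ ^ (t + 1))).subtype
        (torsionBy R N (ϖ ^ t) ⊔ ϖ • torsionBy R N (ϖ ^ (t + 2))))) =
      ((Finset.univ.filter fun i ↦ a i = t + 1).card : ℕ∞) := by
  classical
  haveI : Module.Finite R N := Module.Finite.equiv e.symm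
  have h := length_torsionLayer_add_length (N := N) ϖ t
  rw [length_torsionBy_inf_smul_top_eq_finrank hϖ, length_torsionBy_inf_smul_top_eq_finrank hϖ,
    finrank_torsionBy_smul_top_eq_card_of_linearEquiv hϖ e,
    finrank_torsionBy_smul_top_eq_card_of_linearEquiv hϖ e] at h
  have hsplit : (Finset.univ.filter fun i ↦ t < a i) =
      (Finset.univ.filter fun i ↦ a i = t + 1) ∪ (Finset.univ.filter fun i ↦ t + 1 < a i) := by
    ext i
    simp only [Finset.mem_filter, Finset.mem_univ, true_and, Finset.mem_union]
    constructor <;> intro h <;> omega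
  have hdisj : Disjoint (Finset.univ.filter fun i ↦ a i = t + 1)
      (Finset.univ.filter fun i ↦ t + 1 < a i) := by
    rw [Finset.disjoint_filter]
    intro i _ h1
    omega
  rw [hsplit, Finset.card_union_of_disjoint hdisj, Nat.cast_add] at h
  exact ENat.add_left_injective_of_ne_top (ENat.coe_ne_top _) h

end DVR

/-! ### §3 Pairing up the summands: `N ≅ (R/ϖᵏ)ᵈ ⊕ M ⊕ M` and `N ≅ (R/ϖᵏ)^ε ⊕ M ⊕ M`, `ε ≤ 1` -/

section Halving

/-- `Even (c : ℕ∞)` for a natural number `c` means `Even c`. [folklore] -/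
private theorem even_of_even_natCast {c : ℕ} (h : Even (c : ℕ∞)) : Even c := by
  obtain ⟨r, hr⟩ := h
  have hr' : r ≠ ⊤ := by
    rintro rfl
    exact ENat.coe_ne_top c (by rw [hr, top_add])
  lift r to ℕ using hr'
  exact ⟨r, by exact_mod_cast hr⟩

/-- **Halving a labelling with even fibres**: if every fibre of `a : ι → ℕ` (`ι` finite) has even
cardinality, there is a finite type `κ`, a labelling `b : κ → ℕ` and a bijection `ι ≃ κ ⊕ κ` carrying
`a` to `b ⊔ b`. [folklore] -/
private theorem exists_equiv_sum_self_of_even_card_fiber {ι : Type*} [Fintype ι] (a : ι → ℕ)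
    (h : ∀ y, Even (Fintype.card {i // a i = y})) :
    ∃ (κ : Type) (_ : Fintype κ) (b : κ → ℕ) (σ : ι ≃ κ ⊕ κ),
      ∀ x, a (σ.symm x) = Sum.elim b b x := by
  classical
  let T : Finset ℕ := Finset.univ.image a
  let a' : ι → T := fun i ↦ ⟨a i, Finset.mem_image_of_mem a (Finset.mem_univ i)⟩
  have hc : ∀ y : T, ∃ c : ℕ, Fintype.card {i // a' i = y} = c + c := fun y ↦ by
    obtain ⟨c, hc⟩ := h y
    refine ⟨c, ?_⟩
    rw [← hc]
    exact Fintype.card_congr (Equiv.subtypeEquivRight fun i ↦ Subtype.ext_iff)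
  choose c hc using hc
  let φ : ∀ y : T, {i // a' i = y} ≃ Fin (c y) ⊕ Fin (c y) := fun y ↦
    (Fintype.equivFinOfCardEq (hc y)).trans finSumFinEquiv.symm
  let σ : ι ≃ (Σ y : T, Fin (c y)) ⊕ (Σ y : T, Fin (c y)) :=
    (Equiv.sigmaFiberEquiv a').symm.trans
      ((Equiv.sigmaCongrRight φ).trans (Equiv.sigmaSumDistrib _ _))
  refine ⟨(Σ y : T, Fin (c y)), inferInstance, fun x ↦ ((x.1 : T) : ℕ), σ, ?_⟩
  rintro (⟨y, j⟩ | ⟨y, j⟩)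
  · exact congrArg Subtype.val ((φ y).symm (Sum.inl j)).2
  · exact congrArg Subtype.val ((φ y).symm (Sum.inr j)).2

variable {R : Type*} [CommRing R] [IsDomain R] {ϖ : R} {N : Type*} [AddCommGroup N] [Module R N]

/-- **Pairing up the summands.** If `N ≅ Π_i R/(ϖ^{aᵢ})` with all `aᵢ ≤ k` and, for every `y < k`, an
EVEN number of indices `i` with `aᵢ = y`, then `N ≅ (R/(ϖᵏ))ᵈ × (M × M)` with `M = Π_x R/(ϖ^{b_x})` a
product over half of the indices of exponent `< k` (`d` = the number of indices of exponent `k`).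
This is "the claim then follows easily from this and the structure theorem" in the proof of Howard's
structure theorem, over any integral domain. [cite: Howard2004HeegnerKolyvagin, Thm. 1.4.2 (proof) = arXiv:1202.6340 Thm. 2.4.2, p0008 L104–L115] -/
theorem exists_linearEquiv_pi_prod_pi_prod_self_of_even_card_fiber {ι : Type*} [Fintype ι]
    {a : ι → ℕ} (e : N ≃ₗ[R] Π i, R ⧸ Ideal.span {ϖ ^ a i}) (k : ℕ) (hak : ∀ i, a i ≤ k)
    (heven : ∀ y, y < k → Even (Fintype.card {i // a i = y})) :
    ∃ (κ : Type) (_ : Fintype κ) (b : κ → ℕ), (∀ x, b x < k) ∧ (∀ x, ∃ i, b x = a i) ∧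
      Nonempty (N ≃ₗ[R] (Fin (Fintype.card {i // a i = k}) → R ⧸ Ideal.span {ϖ ^ k}) ×
        ((Π x, R ⧸ Ideal.span {ϖ ^ b x}) × (Π x, R ⧸ Ideal.span {ϖ ^ b x}))) := by
  classical
  let P : ι → Prop := fun i ↦ a i = k
  -- (i) split the index set into the exponent-`k` part and the rest
  let aP : {i // P i} ⊕ {i // ¬P i} → ℕ :=
    Sum.elim (fun s : {i // P i} ↦ a s.1) (fun t : {i // ¬P i} ↦ a t.1)
  obtain ⟨e₁⟩ := nonempty_pi_quotient_linearEquiv_of_associated (R := R) (Equiv.sumCompl P).symm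
    (a := fun i ↦ ϖ ^ a i) (a' := fun x ↦ ϖ ^ aP x) (fun i ↦ by
      by_cases hi : P i
      · rw [Equiv.sumCompl_symm_apply_of_pos hi]
        exact Associated.refl (ϖ ^ a i)
      · rw [Equiv.sumCompl_symm_apply_of_neg hi]
        exact Associated.refl (ϖ ^ a i))
  let e₂ := LinearEquiv.sumPiEquivProdPi R {i // P i} {i // ¬P i}
    (fun x ↦ R ⧸ Ideal.span {ϖ ^ aP x})
  -- (ii) the exponent-`k` part is `(R/ϖᵏ)ᵈ`
  obtain ⟨e₃⟩ := nonempty_pi_quotient_linearEquiv_of_associated (R := R)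
    (Fintype.equivFin {i // P i}) (a := fun s : {i // P i} ↦ ϖ ^ a s.1)
    (a' := fun _ : Fin (Fintype.card {i // P i}) ↦ ϖ ^ k) (fun s ↦ by
      rw [show a s.1 = k from s.2])
  -- (iii) the rest has even fibres: halve it
  have hJ : ∀ y, Even (Fintype.card {t : {i // ¬P i} // a t.1 = y}) := by
    intro y
    by_cases hy : y = k
    · rw [hy]
      haveI : IsEmpty {t : {i // ¬P i} // a t.1 = k} := ⟨fun t ↦ t.1.2 t.2⟩
      rw [Fintype.card_eq_zero]
      exact ⟨0, rfl⟩
    · rw [Fintype.card_congr (Equiv.subtypeSubtypeEquivSubtype (p := fun i ↦ ¬P i)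
        (q := fun i ↦ a i = y) (fun {i} (hi : a i = y) (hik : a i = k) ↦ hy (hi.symm.trans hik)))]
      rcases lt_or_gt_of_ne hy with hlt | hgt
      · exact heven y hlt
      · haveI : IsEmpty {i // a i = y} :=
          ⟨fun i ↦ absurd (hak i.1) (not_le.2 (by rw [i.2]; exact hgt))⟩
        rw [Fintype.card_eq_zero]
        exact ⟨0, rfl⟩
  obtain ⟨κ, _, b, σ, hσ⟩ := exists_equiv_sum_self_of_even_card_fiber
    (fun t : {i // ¬P i} ↦ a t.1) hJ
  obtain ⟨e₄⟩ := nonempty_pi_quotient_linearEquiv_of_associated (R := R) σ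
    (a := fun t : {i // ¬P i} ↦ ϖ ^ a t.1) (a' := fun x ↦ ϖ ^ Sum.elim b b x) (fun t ↦ by
      rw [← hσ (σ t), Equiv.symm_apply_apply])
  let e₅ := LinearEquiv.sumPiEquivProdPi R κ κ (fun x ↦ R ⧸ Ideal.span {ϖ ^ Sum.elim b b x})
  have hb : ∀ x, b x = a (σ.symm (Sum.inl x)).1 := fun x ↦ (hσ (Sum.inl x)).symm
  refine ⟨κ, inferInstance, b, fun x ↦ ?_, fun x ↦ ⟨_, hb x⟩,
    ⟨e.trans (e₁.trans (e₂.trans (e₃.prodCongr (e₄.trans e₅))))⟩⟩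
  rw [hb x]
  exact lt_of_le_of_ne (hak _) (σ.symm (Sum.inl x)).2

/-- **`(R/ϖᵏ)ᵈ ⊕ M ⊕ M ≅ (R/ϖᵏ)^ε ⊕ M' ⊕ M'` with `ε = d mod 2 ≤ 1`** (`M' = (R/ϖᵏ)^{⌊d/2⌋} ⊕ M`): the
normalisation "by the structure theorem for finitely-generated modules over `R`, we may assume
`ε ∈ {0, 1}`". [cite: Howard2004HeegnerKolyvagin, Thm. 1.4.2 = arXiv:1202.6340 Thm. 2.4.2, p0008 L100–L105] -/
theorem exists_linearEquiv_pi_prod_pi_prod_self_fold {κ : Type*} [Fintype κ] {b : κ → ℕ} {k d : ℕ}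
    (e : N ≃ₗ[R] (Fin d → R ⧸ Ideal.span {ϖ ^ k}) ×
      ((Π x, R ⧸ Ideal.span {ϖ ^ b x}) × (Π x, R ⧸ Ideal.span {ϖ ^ b x}))) :
    ∃ (m : ℕ) (n : Fin m → ℕ), (∀ j, n j = k ∨ ∃ x, n j = b x) ∧ (d < 2 → ∀ j, ∃ x, n j = b x) ∧
      Nonempty (N ≃ₗ[R] (Fin (d % 2) → R ⧸ Ideal.span {ϖ ^ k}) ×
        ((Π j, R ⧸ Ideal.span {ϖ ^ n j}) × (Π j, R ⧸ Ideal.span {ϖ ^ n j}))) := by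
  classical
  set q := d / 2 with hq
  have hd : d % 2 + (q + q) = d := by rw [← two_mul]; exact Nat.mod_add_div d 2
  -- `(R/ϖᵏ)ᵈ ≅ (R/ϖᵏ)^ε × ((R/ϖᵏ)^q × (R/ϖᵏ)^q)`
  let C := R ⧸ Ideal.span {ϖ ^ k}
  let f₁ : (Fin d → C) ≃ₗ[R] (Fin (d % 2) → C) × ((Fin q → C) × (Fin q → C)) :=
    ((LinearEquiv.funCongrLeft R C ((finCongr hd.symm).trans finSumFinEquiv.symm).symm).trans
      (LinearEquiv.sumArrowLequivProdArrow (Fin (d % 2)) (Fin (q + q)) R C)).trans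
      ((LinearEquiv.refl R _).prodCongr
        ((LinearEquiv.funCongrLeft R C finSumFinEquiv).trans
          (LinearEquiv.sumArrowLequivProdArrow (Fin q) (Fin q) R C)))
  -- regroup and merge `(R/ϖᵏ)^q × M` into one product over `Fin q ⊕ κ`
  let n₀ : Fin q ⊕ κ → ℕ := Sum.elim (fun _ ↦ k) b
  let g : ((Fin q → C) × (Π x, R ⧸ Ideal.span {ϖ ^ b x})) ≃ₗ[R] Π y, R ⧸ Ideal.span {ϖ ^ n₀ y} :=
    (LinearEquiv.sumPiEquivProdPi R (Fin q) κ (fun y ↦ R ⧸ Ideal.span {ϖ ^ n₀ y})).symm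
  let τ := Fintype.equivFin (Fin q ⊕ κ)
  let n : Fin (Fintype.card (Fin q ⊕ κ)) → ℕ := fun j ↦ n₀ (τ.symm j)
  obtain ⟨g'⟩ := nonempty_pi_quotient_linearEquiv_of_associated (R := R) τ
    (a := fun y ↦ ϖ ^ n₀ y) (a' := fun j ↦ ϖ ^ n j) (fun y ↦ by
      simp only [n, Equiv.symm_apply_apply]
      exact Associated.refl _)
  refine ⟨Fintype.card (Fin q ⊕ κ), n, fun j ↦ ?_, fun hd2 j ↦ ?_, ⟨e.trans ((f₁.prodCongr
    (LinearEquiv.refl R _)).trans ((LinearEquiv.prodAssoc R _ _ _).trans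
    ((LinearEquiv.refl R _).prodCongr ((LinearEquiv.prodProdProdComm R _ _ _ _).trans
    ((g.trans g').prodCongr (g.trans g'))))))⟩⟩
  · simp only [n]
    rcases τ.symm j with i | x
    · exact Or.inl rfl
    · exact Or.inr ⟨x, rfl⟩
  · simp only [n]
    have hq0 : q = 0 := by omega
    rcases hj : τ.symm j with i | x
    · exact (Fin.cast hq0 i).elim0
    · exact ⟨x, rfl⟩

end Halving

/-! ### §4 The structure theorem from even layers (Howard 2004, Thm. 1.4.2 — algebraic half) -/

section Structure

variable {R : Type*} [CommRing R] [IsDomain R] [IsDiscreteValuationRing R] {ϖ : R}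
variable {N : Type*} [AddCommGroup N] [Module R N]

omit [IsDiscreteValuationRing R] in
/-- If `ϖᵏ` kills `N ≅ Π R/(ϖ^{aᵢ})` then every `aᵢ ≤ k`. [folklore] -/
private theorem exponent_le_of_linearEquiv_of_pow_smul_eq_zero (hϖ : Irreducible ϖ) {ι : Type*} {a : ι → ℕ}
    (e : N ≃ₗ[R] Π i, R ⧸ Ideal.span {ϖ ^ a i}) {k : ℕ} (hk : ∀ x : N, ϖ ^ k • x = 0) (i : ι) :
    a i ≤ k := by
  classical
  have h1 : ϖ ^ k • (Pi.single i 1 : Π i, R ⧸ Ideal.span {ϖ ^ a i}) = 0 := by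
    have h := hk (e.symm (Pi.single i 1))
    rwa [← LinearEquiv.map_smul, e.symm.map_eq_zero_iff] at h
  have h2 := congr_fun h1 i
  rw [Pi.smul_apply, Pi.single_eq_same, Pi.zero_apply, Algebra.smul_def, mul_one,
    Ideal.Quotient.algebraMap_eq, Ideal.Quotient.eq_zero_iff_mem, Ideal.mem_span_singleton] at h2
  exact (pow_dvd_pow_iff hϖ.ne_zero hϖ.not_isUnit).1 h2

/-- **HOWARD 2004, THM. 1.4.2 — THE ALGEBRAIC HALF.** Let `R` be a discrete valuation ring with
uniformiser `ϖ`, `N` a finitely generated `R`-module killed by `ϖᵏ`, and suppose that for every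
`1 ≤ s < k` Howard's layer `V_s/V_{s-1} = N[ϖˢ]/(N[ϖ^{s-1}] + ϖN[ϖ^{s+1}])` has EVEN length. Then
`N ≅ (R/ϖᵏ)^ε ⊕ M ⊕ M` with `ε ∈ {0, 1}` and `M = Π_j R/(ϖ^{n_j})`, `1 ≤ n_j ≤ k` ("We claim that for
`0 ≤ s < k`, the `R/𝔪`-vector space `V_s` [read `V_s/V_{s-1}`] is even dimensional. The claim then follows
easily from this and the structure theorem for finitely-generated `R`-modules … we may assume
`ε ∈ {0,1}`"). In Howard's proof the evenness comes from the generalized Cassels–Tate pairing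
(Prop. 1.4.1, Flach) — that input is NOT formalised here; see `even_length_torsionLayer_of_isAlt` for
the form in which it enters. [cite: Howard2004HeegnerKolyvagin, Thm. 1.4.2 = arXiv:1202.6340 Thm. 2.4.2, p0008 L100–L139] -/
theorem exists_linearEquiv_pi_prod_pi_prod_self_of_even_length_torsionLayer (hϖ : Irreducible ϖ)
    [Module.Finite R N] {k : ℕ} (hk : ∀ x : N, ϖ ^ k • x = 0)
    (heven : ∀ t : ℕ, t + 1 < k → Even (Module.length R
      ((↥(torsionBy R N (ϖ ^ (t + 1))) ⧸ comap (torsionBy R N (ϖ ^ (t + 1))).subtype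
        (torsionBy R N (ϖ ^ t) ⊔ ϖ • torsionBy R N (ϖ ^ (t + 2))))))) :
    ∃ (ε m : ℕ) (n : Fin m → ℕ), ε ≤ 1 ∧ (∀ j, 1 ≤ n j ∧ n j ≤ k) ∧
      Nonempty (N ≃ₗ[R] (Fin ε → R ⧸ Ideal.span {ϖ ^ k}) ×
        ((Π j, R ⧸ Ideal.span {ϖ ^ n j}) × (Π j, R ⧸ Ideal.span {ϖ ^ n j}))) := by
  classical
  have hN : Module.IsTorsion R N := fun x ↦
    ⟨⟨ϖ ^ k, mem_nonZeroDivisors_of_ne_zero (pow_ne_zero k hϖ.ne_zero)⟩, hk x⟩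
  obtain ⟨s, a, ha, -, ⟨e⟩⟩ := exists_linearEquiv_pi_quotient_uniformizer_pow_of_isTorsion hϖ N hN
  have hak : ∀ i, a i ≤ k := fun i ↦ exponent_le_of_linearEquiv_of_pow_smul_eq_zero hϖ e hk i
  have heven' : ∀ y, y < k → Even (Fintype.card {i // a i = y}) := by
    intro y hy
    cases y with
    | zero =>
      haveI : IsEmpty {i // a i = 0} := ⟨fun i ↦ (ha i.1).ne' i.2⟩
      rw [Fintype.card_eq_zero]
      exact ⟨0, rfl⟩
    | succ t =>
      have h := heven t hy
      rw [length_torsionLayer_eq_card_of_linearEquiv hϖ e t, ← Fintype.card_subtype] at h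
      exact even_of_even_natCast h
  obtain ⟨κ, _, b, hb, hba, ⟨e'⟩⟩ :=
    exists_linearEquiv_pi_prod_pi_prod_self_of_even_card_fiber e k hak heven'
  obtain ⟨m, n, hn, hn2, ⟨e''⟩⟩ := exists_linearEquiv_pi_prod_pi_prod_self_fold e'
  refine ⟨_, m, n, Nat.lt_succ_iff.1 (Nat.mod_lt _ two_pos), fun j ↦ ?_, ⟨e''⟩⟩
  rcases hn j with h | ⟨x, hx⟩
  · by_cases hd : Fintype.card {i // a i = k} < 2
    · obtain ⟨x, hx⟩ := hn2 hd j
      obtain ⟨i, hi⟩ := hba x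
      exact ⟨by rw [hx, hi]; exact ha i, by rw [hx]; exact (hb x).le⟩
    · obtain ⟨⟨i, hi⟩⟩ : Nonempty {i // a i = k} := Fintype.card_pos_iff.1 (by omega)
      exact ⟨by rw [h, ← hi]; exact ha i, h.le⟩
  · obtain ⟨i, hi⟩ := hba x
    exact ⟨by rw [hx, hi]; exact ha i, by rw [hx]; exact (hb x).le⟩

end Structure

end Literature.Algebra.Module
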